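import Summits.CriticalPhenomena.PercolationContinuityZ3.Theorems.PercNearOneGluingNoHeavyLowerTailAntitheticGlueSource
import HarnessLib

/-!
# `NoHeavyLowerTail` (stmt-CriticalPhenomena-4575) — antithetic cluster pairs: BOX PARTITIONS SURVIVE HANGING ANYTHING AT A CUT VERTEX
# (closure lemma (P2) of HOME/MEMO-gen63.md §6, cf. MEMO-gen62 §3(b); prim-hp-2 gen 63)

Support file (`--supports stmt-CriticalPhenomena-4575`, hull-port prover `prim-hp-2`, gen 63).  No definitions, no named facts, no sorries;
standard axioms.  Notation of …AntitheticBoxes / …GlueSource.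

**`Antithetic.Box.boxes_hang`** (∃-transformer).  Let `W` be an edge set HUNG at a vertex `c` of `E₁`: every vertex common to a pair of
`E₁` and a pair of `W` is `c`, and the source `s` is on no pair of `W`.  Let `P` be a vertex not on `W` unless `P = c`.  Then a partition
of `{P ∈ X_{E₁}}` into red-dominated boxes with fixed pairs inside `E₁` is one of `{P ∈ X_{E₁ ∪ W}}` — the same boxes, `W` free.
Reason (`Box.cluster_hang_subset`): a cluster of `s` enters `W` only through `c`, so `X_{E₁∪W} = X_{E₁} ∪ [c ∈ X_{E₁}]·(red cluster of
`c` in `W`)` and likewise for `Y`; if `c ∈ Y_{E₁} T'` then `c ∈ X_{E₁} T` (domination on `E₁`) and the blue `W`-cluster of `c` under the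
antipode `T'` is the red `W`-cluster of `c` under `T` (all non-loop pairs of `W` are free).  Pendant leaves / trees (`Box.dom_insert_leaf`,
`Box.boxes_leaves`) are the special case `W` = a path; here `W` is ARBITRARY (any block structure hung at `c ≠ s`).
Consequence (⊕-HANDLE THEOREM): box-decomposability of `(K, s, P)` — hence CONJECTURE Δ2 for `K` + handle(P,Q) — is insensitive to
anything hung at cut vertices away from `s` and (…GlueSource) to anything glued at `s`.
[cite: VandenbergHaggstromKahn2005, §1 p. 3 (open cluster `C_s`)]
-/

noncomputable section

namespace Summit.CriticalPhenomena.PercolationContinuityZ3.Theorems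

open Literature.Probability.Percolation
open scoped Classical

namespace Antithetic

namespace Box

variable {V : Type*} {E₁ W : Set (Sym2 V)} {s c P : V}

/-- **The cluster of `s` in `E₁ ∪ W` (W hung at `c`, `s` off `W`)**: it is contained in the `E₁`-cluster of `s` together with — if `c`
lies in that cluster — the `W`-cluster of `c` (same colouring `G`). [this work] -/
theorem cluster_hang_subset (hsep : ∀ e₁ ∈ E₁, ∀ e₂ ∈ W, ∀ x : V, x ∈ e₁ → x ∈ e₂ → x = c) (hsW : ∀ e ∈ W, s ∉ e)
    (G : Set (Sym2 V)) :
    openCluster (G ∩ (E₁ ∪ W)) s ⊆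
      openCluster (G ∩ E₁) s ∪ {x | c ∈ openCluster (G ∩ E₁) s ∧ x ∈ openCluster (G ∩ W) c} := by
  refine cluster_subset_of_closed (G ∩ (E₁ ∪ W)) s _ (Or.inl (mem_openCluster_self _ _)) fun a b ha hab => ?_
  rcases hab.2 with h1 | h2
  · -- a pair of `E₁`
    rcases ha with ha | ⟨hc, ha⟩
    · exact Or.inl (Freeze.mem_cluster_of_edge ha ⟨hab.1, h1⟩)
    · by_cases hac : a = c
      · subst hac; exact Or.inl (Freeze.mem_cluster_of_edge hc ⟨hab.1, h1⟩)
      · obtain ⟨e, he, hae⟩ := mem_pair_of_mem_cluster ha hac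
        exact absurd (hsep _ h1 e he a (Sym2.mem_mk_left _ _) hae) hac
  · -- a pair of `W`
    rcases ha with ha | ⟨hc, ha⟩
    · by_cases has : a = s
      · subst has; exact absurd (Sym2.mem_mk_left _ _) (hsW _ h2)
      · obtain ⟨e, he, hae⟩ := mem_pair_of_mem_cluster ha has
        have hac : a = c := hsep e he _ h2 a hae (Sym2.mem_mk_left _ _)
        subst hac
        exact Or.inr ⟨ha, Freeze.mem_cluster_of_edge (mem_openCluster_self _ _) ⟨hab.1, h2⟩⟩
    · exact Or.inr ⟨hc, Freeze.mem_cluster_of_edge ha ⟨hab.1, h2⟩⟩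

/-- **Hanging at a cut vertex does not change the red cluster on the first side.**  `W` hung at `c`, `s` off `W`, `P` not on `W` unless
`P = c`: `P ∈ X_{E₁ ∪ W} T ↔ P ∈ X_{E₁} T`. [this work] -/
theorem mem_X_hang_iff (hsep : ∀ e₁ ∈ E₁, ∀ e₂ ∈ W, ∀ x : V, x ∈ e₁ → x ∈ e₂ → x = c) (hsW : ∀ e ∈ W, s ∉ e)
    (hP : ∀ e ∈ W, P ∈ e → P = c) (T : Set (Sym2 V)) :
    P ∈ openCluster (T ∩ (E₁ ∪ W)) s ↔ P ∈ openCluster (T ∩ E₁) s := by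
  constructor
  · intro h
    rcases cluster_hang_subset hsep hsW T h with h1 | ⟨hc, hPW⟩
    · exact h1
    · by_cases hPc : P = c
      · rw [hPc]; exact hc
      · obtain ⟨e, he, hPe⟩ := mem_pair_of_mem_cluster hPW hPc
        exact absurd (hP e he hPe) hPc
  · exact fun h => Freeze.openCluster_mono (Set.inter_subset_inter_right _ Set.subset_union_left) _ h

/-- **Box partitions survive hanging anything at a cut vertex** (∃-transformer).  `W` hung at `c` (meets `E₁` only at `c`), `s` on no
pair of `W`, `P` not on `W` unless `P = c`; boxes `(Fix c', N c')`, `Fix c' ⊆ E₁`, partition `{P ∈ X_{E₁}}` into red-dominated boxes.  Then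
the same boxes partition `{P ∈ X_{E₁ ∪ W}}` into red-dominated boxes (cover / inside / domination for `E₁ ∪ W`). [this work] -/
theorem boxes_hang (hsep : ∀ e₁ ∈ E₁, ∀ e₂ ∈ W, ∀ x : V, x ∈ e₁ → x ∈ e₂ → x = c) (hsW : ∀ e ∈ W, s ∉ e)
    (hP : ∀ e ∈ W, P ∈ e → P = c)
    {C : Type*} (Fix N : C → Set (Sym2 V)) (hFixE : ∀ c', Fix c' ⊆ E₁)
    (hcover : ∀ T : Set (Sym2 V), P ∈ openCluster (T ∩ E₁) s → ∃ c', ∀ e ∈ Fix c', (e ∈ T ↔ e ∈ N c'))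
    (hinside : ∀ c' (T : Set (Sym2 V)), (∀ e ∈ Fix c', (e ∈ T ↔ e ∈ N c')) → P ∈ openCluster (T ∩ E₁) s)
    (hdom : ∀ c' (T T' : Set (Sym2 V)), (∀ e ∈ Fix c', (e ∈ T ↔ e ∈ N c')) → (∀ e ∈ Fix c', (e ∈ T' ↔ e ∈ N c')) →
      (∀ e ∉ Fix c', (e ∈ T' ↔ e ∉ T)) → openCluster (T'ᶜ ∩ E₁) s ⊆ openCluster (T ∩ E₁) s) :
    (∀ c', Fix c' ⊆ E₁ ∪ W) ∧
    (∀ T : Set (Sym2 V), P ∈ openCluster (T ∩ (E₁ ∪ W)) s → ∃ c', ∀ e ∈ Fix c', (e ∈ T ↔ e ∈ N c')) ∧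
    (∀ c' (T : Set (Sym2 V)), (∀ e ∈ Fix c', (e ∈ T ↔ e ∈ N c')) → P ∈ openCluster (T ∩ (E₁ ∪ W)) s) ∧
    (∀ c' (T T' : Set (Sym2 V)), (∀ e ∈ Fix c', (e ∈ T ↔ e ∈ N c')) → (∀ e ∈ Fix c', (e ∈ T' ↔ e ∈ N c')) →
      (∀ e ∉ Fix c', (e ∈ T' ↔ e ∉ T)) → openCluster (T'ᶜ ∩ (E₁ ∪ W)) s ⊆ openCluster (T ∩ (E₁ ∪ W)) s) := by
  refine ⟨fun c' => (hFixE c').trans Set.subset_union_left, fun T hT => hcover T ((mem_X_hang_iff hsep hsW hP T).1 hT),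
    fun c' T hT => (mem_X_hang_iff hsep hsW hP T).2 (hinside c' T hT), fun c' T T' hT hT' hflip y hy => ?_⟩
  have hmono : openCluster (T ∩ E₁) s ⊆ openCluster (T ∩ (E₁ ∪ W)) s :=
    Freeze.openCluster_mono (Set.inter_subset_inter_right _ Set.subset_union_left) _
  rcases cluster_hang_subset hsep hsW T'ᶜ hy with h1 | ⟨hc, hyW⟩
  · exact hmono (hdom c' T T' hT hT' hflip h1)
  · -- `c ∈ Y_{E₁} T' ⊆ X_{E₁} T`, and the blue `W`-cluster of `c` under `T'` is red under `T` (the non-loop pairs of `W` are free)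
    have hcX : c ∈ openCluster (T ∩ (E₁ ∪ W)) s := hmono (hdom c' T T' hT hT' hflip hc)
    refine hcX.trans (SimpleGraph.Reachable.mono (fun a b hab => ?_) hyW)
    rw [openGraph_adj] at hab ⊢
    obtain ⟨⟨hT'c, hWe⟩, hne⟩ := hab
    have hnot1 : s(a, b) ∉ E₁ := by
      intro h1
      have ha := hsep _ h1 _ hWe a (Sym2.mem_mk_left _ _) (Sym2.mem_mk_left _ _)
      have hb := hsep _ h1 _ hWe b (Sym2.mem_mk_right _ _) (Sym2.mem_mk_right _ _)
      exact hne (ha.trans hb.symm)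
    have hred : s(a, b) ∈ T := by
      by_contra h
      exact hT'c ((hflip _ fun hF => hnot1 (hFixE c' hF)).2 h)
    exact ⟨⟨hred, Or.inr hWe⟩, hne⟩

end Box

end Antithetic

end Summit.CriticalPhenomena.PercolationContinuityZ3.Theorems
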